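import Summits.QuantumFields.YangMills.Theorems.UnitScaleTiltProp7LocMinOfJointRow
import Summits.QuantumFields.YangMills.Theorems.UnitScaleTiltProp7FirstVariationExactPairing
import Summits.QuantumFields.YangMills.Theorems.UnitScaleTiltProp7CurvedLandauRowA
import HarnessLib

/-!
# Route `UnitScaleTilt`, crux K1 child «MinimiserStabilityRegPr» (stmt-QuantumFields-19200) — THE GROWTH-SIDE DOOR IN MULTIPLIER CURRENCY:
# E′ ⇐ CHART_W ∧ HESS_W′ ∧ ONE JOINT REMAINDER ROW `Σ_c‖Q^{(K−n)}_W(iD)(c)‖ ≤ C₁·ℓ⁻¹·Σ‖D‖² + C₂·ℓ·Σ_p‖ℒ_p(D)‖²` — no fibre curve, no velocity `ξ`, no `c_N`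

Cell `ym3-torus` ∕ fleet seat `ym-ust-19200-p1` (gen 13, route-R lead).  THEOREMS ONLY (0 `def`, 0 `sorry`); `--supports stmt-QuantumFields-19200`, count-neutral.
YM₃ on T³ is a ladder rung (R3), not the Clay problem; nothing here claims the stub, the crux, d = 4 or the mass gap; E′ is NOT closed by this file.

WHY (★w4-19200 g4 LOCATE 2026-08-28T12:41:57Z + this seat's CONFIRM 12:50Z).  ✓`PV3ESigmaUniform.isMinOn_regFibrePr_of_sliceRows_at` charges the first variation along a
competitor direction `D` through a Σ_k-curve velocity `ξ` and the NORMAL row `Σ_b‖iD(b) − ξ(b)‖ ≤ c_N·Σ‖D‖²` at the current's rate `e·ℓ⁻³` (`ℓ = L^{K−n}`); the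
located fact is that no corrector delivers `c_N = c₀ℓ` (`≈ c·ℓ⁴` via the central-bond corrector).  In MULTIPLIER currency the corrector disappears: at an R2-critical
`W ∈ (6)(e)` the exact-pairing theorem ✓`Prop7FirstVariationExactPairing.abs_lin_le_sum_norm_trueLinIter` (★routeR-w2 g1) bounds the first variation along ANY
`𝔰𝔲(2)`-valued `A` by `2e·ℓ⁻¹·Σ_c‖(Q^{(K−n)}_W A)(c)‖` — the `ℓ¹` norm of the TRUE linearised `(K−n)`-fold (0.4)-average of `A` (`Q` = any recursion family of record,
zero content: ✓`Prop7CurvedLandauRowA.exists_trueLinIter_family`).  For a chart point `e^{iD}W` ON the fibre, `Q^{(K−n)}_W(iD)` is minus the second-order remainder of the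
average, so the honest third growth-side row is a JOINT bound of that `ℓ¹` norm by `C₁·ℓ⁻¹·(mass) + C₂·ℓ·(linearised relative curvature)`: the `C₂·ℓ` term is
necessary (block-periodic half-trunk family: remainder `≈ t·ℓ·(ℓ⁻¹·mass)`, paid by `(t∕4)·curl`) and affordable, since it enters the action at rate `2e·ℓ⁻¹`, i.e. as
`2eC₂·Σ_p‖ℒ_p(D)‖²` against Taylor's `¼·Σ_p‖ℒ_p(D)‖²` (θ = ½ in ✓`Prop7Taylor3Uniform.wilsonAction4_expChart_sub_lin_ge`).

THE ARITHMETIC (now ★w4's ✓`linRow_of_QRows` + `wilsonAction4_le_expChart_of_linRow`, p635515 13:08Z; this file instantiates `R`).  `A(e^{iD}W) − A(W) ≥ Lin_W(iD) + ¼K − (15552s² + 216·eℓ⁻²)M` (Taylor, `K = Σ_p‖ℒ_p(D)‖²`, `M = Σ_b‖D(b)‖²`), `|Lin_W(iD)| ≤ 2eℓ⁻¹(C₁ℓ⁻¹M + C₂ℓK)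
= 2eC₁ℓ⁻²M + 2eC₂K`, `κM ≤ K` ⇒ `A(e^{iD}W) − A(W) ≥ [(¼ − 2eC₂)κ − 15552s² − 216eℓ⁻² − 2eC₁ℓ⁻²]·M ≥ 0` once `2eC₂ ≤ ⅛` and
`15552s² + 216·regThreshold(e) + 2eC₁ℓ⁻² ≤ κ∕8`; with `s = s₀ℓ⁻¹`, `κ = κ₀ℓ⁻²` this is the `L`-only condition `15552s₀² + 216e₆ + 2e₆C₁ ≤ κ₀∕8`, `16e₆C₂ ≤ 1`.

WHAT IS PROVED (ns `…Theorems.Prop7LocMinOfMultiplierRows`).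
* §1 `I_smul_mem_skewAdjoint`, `trace_I_smul_eq_zero` (letters); ★★ `isMinOn_regFibrePr_of_multiplierRows_at` (= ★w4's ✓`Prop7LocMinOfJointRow.isMinOn_regFibrePr_of_linRows_at`
  ∘ `linRow_of_QRows` with `R := Σ_c‖Q (K−n) (iD) c‖` DISCHARGED by ✓`abs_lin_le_sum_norm_trueLinIter`) — one member, one datum: rows CHART_W (`‖D(b)‖ ≤ s`,
  `A(W′) = A(e^{iD}W)`), HESS_W′ (`κM ≤ K`), JOINT (`Σ_c‖Q^{(K−n)}_W(iD)(c)‖ ≤ C₁ℓ⁻¹M + C₂ℓK`) for every competitor, any recursion family `Q` at `W` (displayed),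
  window `10¹⁰L⁶e ≤ 1`, `4s ≤ 1`, `2eC₂ ≤ ⅛`, `15552s² + 216·regThreshold(e) + 2eC₁ℓ⁻² ≤ κ∕8` ⇒ `W` minimises over (6)(e) ∩ 𝔅_k(V).
* §2 `scaled_smallness_mult` (the `ℓ`-bookkeeping) and ★★★ `stub_PV3E_of_multiplierRows`: the E′ TEXT OF RECORD (verbatim as in ✓`PV3ESigmaUniform.stub_PV3E_of_sliceRows`,
  `e₅ := e₆`, `a₁'' := 1`) from ONE displayed uniform hypothesis with `L`-only constants `e₆, s₀, C₁, C₂, κ₀`.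
HONEST SCOPE.  Bookkeeping over landed letters.  DISPLAYED, not proved: CHART_W ([Balaban1985RegularSpaces] Thm 2 at the critical background), HESS_W′ ((116) ∕
[Balaban1985BackgroundPropagators] Thm 3.11–3.12; supplier (H1) ★routeR-w3 `…Prop7HessWOfFibreCoreT3`), and the JOINT remainder row (the `ℓ¹` two-point remainder of the
`(K−n)`-fold (0.4)-average on the fibre in `(mass, curl)` currency — [Balaban1985Variational] (47)–(48), (80); supplier lane ★routeR-w1's N3a∕N3b).  Numerics at constrained
critical backgrounds (this seat, kit j308958: ℓ = 3, ε₀(U_k) = 0.39): the fraction of the linearised relative curvature eaten by the first variation over ALL slice directions is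
`θ_needed = 0.019 ≪ ¼` and `ℓ²λ_min(HL − ½K) = 9.0 > 0` — evidence, not proof.

References: T. Bałaban, CMP 102 (1985) 277–309 [Balaban1985Variational] ((2), (4)–(7) p.278, (14) p.280, (47)–(48) pp.285–286, (80) p.290, (116) p.295, (141)–(142), Prop. 7 p.299);
CMP 99 (1985) 389–434 [Balaban1985BackgroundPropagators] ((3.9)–(3.11) p.392, Thm 3.11 p.416); CMP 99 (1985) 75–102 [Balaban1985RegularSpaces] (Thm 2 p.83);
CMP 98 (1985) 17–51 [Balaban1985Averaging] ((11) p.19, (122)–(125) p.36).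
-/

set_option autoImplicit false
noncomputable section

open scoped BigOperators Matrix.Norms.L2Operator Matrix Topology
open Filter

namespace Summit.QuantumFields.YangMills.Theorems.Prop7LocMinOfMultiplierRows

open Literature.MathematicalPhysics.QuantumFieldTheory.Balaban1983to89
open Literature.MathematicalPhysics.QuantumFieldTheory.Balaban1983to89.T3ContinuumYM3Torus
open Literature.MathematicalPhysics.QuantumFieldTheory.Balaban1983to89.T3UnitLawDensityEML (ℰp)
open Literature.MathematicalPhysics.QuantumFieldTheory.Balaban1983to89.T3ConstrainedMinimiser
open Literature.MathematicalPhysics.QuantumFieldTheory.Balaban1983to89.T3Thm1Carrier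
open Literature.MathematicalPhysics.QuantumFieldTheory.Balaban1983to89.T3PrintedRegularMinimiser
open Literature.MathematicalPhysics.QuantumFieldTheory.Balaban1983to89.T3RegularMinimiser
open Literature.MathematicalPhysics.QuantumFieldTheory.Balaban1983to89.T3Thm1CarrierNative (IsCritR2)
open Literature.MathematicalPhysics.QuantumFieldTheory.Balaban1983to89.T3SectALandauChart (emb15 CloseAvg pos_of_regPr)
open T4Continuum BlockAveraging AveragingRT ExpMeanLog BlockAveragingEMLLinearised BlockAveragingEMLLinearisedBackground BlockAveragingEMLProp2
open Summit.QuantumFields.YangMills.Theorems.Prop7TPrint (expHermField)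
open Summit.QuantumFields.YangMills.Theorems.Prop7LocMinOfJointRow (isMinOn_regFibrePr_of_linRows_at linRow_of_QRows)
open Summit.QuantumFields.YangMills.Theorems.Prop7FirstVariationExactPairing (abs_lin_le_sum_norm_trueLinIter)
open Summit.QuantumFields.YangMills.Theorems.Prop7CurvedLandauRowA (exists_trueLinIter_family)

/-! ## §1 One member, one datum -/

/-- `iD` is skew-adjoint for Hermitian `D ∈ M₂(ℂ)`. [folklore] -/
theorem I_smul_mem_skewAdjoint {D : Matrix (Fin 2) (Fin 2) ℂ} (hD : D.IsHermitian) : Complex.I • D ∈ skewAdjoint (Matrix (Fin 2) (Fin 2) ℂ) := by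
  rw [skewAdjoint.mem_iff, star_smul, Complex.star_def, Complex.conj_I, Matrix.star_eq_conjTranspose, hD.eq, neg_smul]

/-- `tr(iD) = 0` when `tr D = 0`. [folklore] -/
theorem trace_I_smul_eq_zero {D : Matrix (Fin 2) (Fin 2) ℂ} (hD : Matrix.trace D = 0) : Matrix.trace (Complex.I • D) = 0 := by
  rw [Matrix.trace_smul, hD, smul_zero]

set_option maxHeartbeats 400000 in
/-- ★★ **E′ AT A DATUM FROM CHART_W ∧ HESS_W′ ∧ THE JOINT REMAINDER ROW, IN MULTIPLIER CURRENCY.**  `W ∈ (6)(e) ∩ 𝔅_k(V)` R2-critical, `10¹⁰L⁶e ≤ 1`; `Q` any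
recursion family of the true one-step linearisations along `W`'s tower (displayed, zero content).  Every competitor `W′ ∈ (6)(e) ∩ 𝔅_k(V)` comes with a
Hermitian-traceless `D`, `‖D(b)‖ ≤ s`, `A(W′) = A(e^{iD}W)`, the slice gap `κ·Σ‖D‖² ≤ Σ_p‖ℒ_p(D)‖²` and the JOINT row
`Σ_c‖(Q (K−n) (iD))(c)‖ ≤ C₁·(L^{K−n})⁻¹·Σ‖D‖² + C₂·L^{K−n}·Σ_p‖ℒ_p(D)‖²`.  If `4s ≤ 1`, `2eC₂ ≤ ⅛` and
`15552s² + 216·regThreshold(e) + 2eC₁·(L^{K−n})⁻²  ≤ κ∕8`, then `W` minimises the Wilson action over (6)(e) ∩ 𝔅_k(V).  The first variation is charged by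
✓`abs_lin_le_sum_norm_trueLinIter` (rate `2e·(L^{K−n})⁻¹` on the `ℓ¹` norm of `Q (K−n) (iD)`); the action-level step is ★w4's socket
✓`isMinOn_regFibrePr_of_linRows_at` ∘ ✓`linRow_of_QRows` (Taylor at θ = ½ inside).
[cite: Balaban1985Variational, (141)-(142) p.299, (47)-(48) pp.285-286, (116) p.295, (6) p.278; Balaban1985BackgroundPropagators, (3.9)-(3.11) p.392] -/
theorem isMinOn_regFibrePr_of_multiplierRows_at (F : T3Family) {n K : ℕ} (h : n ≤ K) {e s κ C₁ C₂ : ℝ}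
    (V : GaugeField (F.P n) 0 (Matrix.specialUnitaryGroup (Fin 2) ℂ)) {W : GaugeField (F.P K) 0 (Matrix.specialUnitaryGroup (Fin 2) ℂ)}
    (hW : IsCritR2 F n K h V W) (hWe : W ∈ regFibrePr F n K h e V) (he : 10 ^ 10 * (F.L : ℝ) ^ 6 * e ≤ 1)
    (Q : (k : ℕ) → (PBond (F.P K) 0 → Matrix (Fin 2) (Fin 2) ℂ) → PBond (F.P K) k → Matrix (Fin 2) (Fin 2) ℂ) (hQ0 : ∀ Y, Q 0 Y = Y)
    (hQs : ∀ (k : ℕ) (Y : PBond (F.P K) 0 → Matrix (Fin 2) (Fin 2) ℂ) (c : PBond (F.P K) (k + 1)), Q (k + 1) Y c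
      = fderiv ℂ (eml : (Idx (F.P K) → Matrix (Fin 2) (Fin 2) ℂ) → Matrix (Fin 2) (Fin 2) ℂ)
            (fun i => ((loopHol (Averaging.iter (fun i => blockAvg (P := F.P K) (j := i) (expMeanLogSU (n := Fin 2))) k W) c i :
              Matrix.specialUnitaryGroup (Fin 2) ℂ) : Matrix (Fin 2) (Fin 2) ℂ))
            (fun i => covWalkSum (Averaging.iter (fun i => blockAvg (P := F.P K) (j := i) (expMeanLogSU (n := Fin 2))) k W) (Q k Y)
                (walk (emb c.src) (loopWord (F.P K).L c.dir (off i.1) i.2.1 i.2.2))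
              * ((loopHol (Averaging.iter (fun i => blockAvg (P := F.P K) (j := i) (expMeanLogSU (n := Fin 2))) k W) c i :
                Matrix.specialUnitaryGroup (Fin 2) ℂ) : Matrix (Fin 2) (Fin 2) ℂ))
            * star ((corr (expMeanLogSU (n := Fin 2)) (Averaging.iter (fun i => blockAvg (P := F.P K) (j := i) (expMeanLogSU (n := Fin 2))) k W) c :
                Matrix.specialUnitaryGroup (Fin 2) ℂ) : Matrix (Fin 2) (Fin 2) ℂ)
          + ((corr (expMeanLogSU (n := Fin 2)) (Averaging.iter (fun i => blockAvg (P := F.P K) (j := i) (expMeanLogSU (n := Fin 2))) k W) c :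
                Matrix.specialUnitaryGroup (Fin 2) ℂ) : Matrix (Fin 2) (Fin 2) ℂ)
            * covWalkSum (Averaging.iter (fun i => blockAvg (P := F.P K) (j := i) (expMeanLogSU (n := Fin 2))) k W) (Q k Y)
                (walk (emb c.src) (List.replicate (F.P K).L (c.dir, true)))
            * star ((corr (expMeanLogSU (n := Fin 2)) (Averaging.iter (fun i => blockAvg (P := F.P K) (j := i) (expMeanLogSU (n := Fin 2))) k W) c :
                Matrix.specialUnitaryGroup (Fin 2) ℂ) : Matrix (Fin 2) (Fin 2) ℂ))
    (hrows : ∀ W' : GaugeField (F.P K) 0 (Matrix.specialUnitaryGroup (Fin 2) ℂ), W' ∈ regFibrePr F n K h e V →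
        ∃ (D : PBond (F.P K) 0 → Matrix (Fin 2) (Fin 2) ℂ),
          (∀ b : PBond (F.P K) 0, (D b).IsHermitian ∧ Matrix.trace (D b) = 0) ∧ (∀ b : PBond (F.P K) 0, ‖D b‖ ≤ s) ∧
          wilsonAction4 W' = wilsonAction4 (emb15 W (expHermField D)) ∧
          κ * ∑ b : PBond (F.P K) 0, ‖D b‖ ^ 2
            ≤ ∑ p : Plaq (F.P K) 0, ‖((Complex.I • D ⟨p.src, p.μ⟩) + ((W ⟨p.src, p.μ⟩ : Matrix (Fin 2) (Fin 2) ℂ) * (Complex.I • D ⟨p.src.shift p.μ, p.ν⟩) * star (W ⟨p.src, p.μ⟩ : Matrix (Fin 2) (Fin 2) ℂ))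
            - (((W ⟨p.src, p.μ⟩ * W ⟨p.src.shift p.μ, p.ν⟩ * (W ⟨p.src.shift p.ν, p.μ⟩)⁻¹ : Matrix.specialUnitaryGroup (Fin 2) ℂ) : Matrix (Fin 2) (Fin 2) ℂ) * (Complex.I • D ⟨p.src.shift p.ν, p.μ⟩) * star ((W ⟨p.src, p.μ⟩ * W ⟨p.src.shift p.μ, p.ν⟩ * (W ⟨p.src.shift p.ν, p.μ⟩)⁻¹ : Matrix.specialUnitaryGroup (Fin 2) ℂ) : Matrix (Fin 2) (Fin 2) ℂ))
            - (((GaugeField.plaqHol W p : Matrix.specialUnitaryGroup (Fin 2) ℂ) : Matrix (Fin 2) (Fin 2) ℂ) * (Complex.I • D ⟨p.src, p.ν⟩) * star ((GaugeField.plaqHol W p : Matrix.specialUnitaryGroup (Fin 2) ℂ) : Matrix (Fin 2) (Fin 2) ℂ)))‖ ^ 2 ∧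
          ∑ c : PBond (F.P K) (K - n), ‖Q (K - n) (fun b => Complex.I • D b) c‖
            ≤ C₁ * ((F.L : ℝ) ^ (K - n))⁻¹ * ∑ b : PBond (F.P K) 0, ‖D b‖ ^ 2
              + C₂ * (F.L : ℝ) ^ (K - n) * ∑ p : Plaq (F.P K) 0, ‖((Complex.I • D ⟨p.src, p.μ⟩) + ((W ⟨p.src, p.μ⟩ : Matrix (Fin 2) (Fin 2) ℂ) * (Complex.I • D ⟨p.src.shift p.μ, p.ν⟩) * star (W ⟨p.src, p.μ⟩ : Matrix (Fin 2) (Fin 2) ℂ))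
            - (((W ⟨p.src, p.μ⟩ * W ⟨p.src.shift p.μ, p.ν⟩ * (W ⟨p.src.shift p.ν, p.μ⟩)⁻¹ : Matrix.specialUnitaryGroup (Fin 2) ℂ) : Matrix (Fin 2) (Fin 2) ℂ) * (Complex.I • D ⟨p.src.shift p.ν, p.μ⟩) * star ((W ⟨p.src, p.μ⟩ * W ⟨p.src.shift p.μ, p.ν⟩ * (W ⟨p.src.shift p.ν, p.μ⟩)⁻¹ : Matrix.specialUnitaryGroup (Fin 2) ℂ) : Matrix (Fin 2) (Fin 2) ℂ))
            - (((GaugeField.plaqHol W p : Matrix.specialUnitaryGroup (Fin 2) ℂ) : Matrix (Fin 2) (Fin 2) ℂ) * (Complex.I • D ⟨p.src, p.ν⟩) * star ((GaugeField.plaqHol W p : Matrix.specialUnitaryGroup (Fin 2) ℂ) : Matrix (Fin 2) (Fin 2) ℂ)))‖ ^ 2)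
    (hs4 : 4 * s ≤ 1) (hθ : 2 * e * C₂ ≤ 1 / 8)
    (hsmall : 15552 * s ^ 2 + 216 * regThreshold F n K e + 2 * e * C₁ * (((F.L : ℝ) ^ (K - n)) ^ 2)⁻¹ ≤ κ / 8) :
    IsMinOn (fun W' : GaugeField (F.P K) 0 (Matrix.specialUnitaryGroup (Fin 2) ℂ) => wilsonAction4 W') (regFibrePr F n K h e V) W := by
  have hreg : RegPr F n K e W := ((mem_regFibrePr_iff F).mp hWe).2
  have he0 : 0 < e := pos_of_regPr F hreg
  refine isMinOn_regFibrePr_of_linRows_at F h V hWe fun W' hW' => ?_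
  obtain ⟨D, hDh, hDs, hA, hq, hJ⟩ := hrows W' hW'
  -- THE MULTIPLIER BOUND along `A := iD` (✓`abs_lin_le_sum_norm_trueLinIter`), then ★w4's `Q`-currency bookkeeping `linRow_of_QRows`
  have hsk : ∀ b : PBond (F.P K) 0, (fun b => Complex.I • D b) b ∈ skewAdjoint (Matrix (Fin 2) (Fin 2) ℂ) := fun b => I_smul_mem_skewAdjoint (hDh b).1
  have htr : ∀ b : PBond (F.P K) 0, ((fun b => Complex.I • D b) b).trace = 0 := fun b => trace_I_smul_eq_zero (hDh b).2
  have hEL := abs_lin_le_sum_norm_trueLinIter F h hW he0 he hreg Q hQ0 hQs (fun b => Complex.I • D b) hsk htr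
  beta_reduce at hEL
  exact ⟨D, s, hDh, hDs, hs4, hA, linRow_of_QRows F he0.le W D hEL hJ hq hθ (by linarith [hsmall])⟩

/-! ## §2 The E′ text of record with `L`-only constants -/

/-- The `ℓ`-bookkeeping: with `ℓ = L^{K−n} ≥ 1`, `s = s₀ℓ⁻¹`, `κ = κ₀ℓ⁻²`, `regThreshold(e) = eℓ⁻²`, the datum smallness is `ℓ⁻²·(15552s₀² + 216e + 2eC₁) ≤ ℓ⁻²·κ₀∕8`. [folklore] -/
theorem scaled_smallness_mult (F : T3Family) (n K : ℕ) {e e₆ s₀ C₁ κ₀ : ℝ} (he : e ≤ e₆) (hC₁ : 0 ≤ C₁)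
    (hsmall : 15552 * s₀ ^ 2 + 216 * e₆ + 2 * e₆ * C₁ ≤ κ₀ / 8) :
    15552 * (s₀ * ((F.L : ℝ) ^ (K - n))⁻¹) ^ 2 + 216 * regThreshold F n K e
        + 2 * e * C₁ * (((F.L : ℝ) ^ (K - n)) ^ 2)⁻¹
      ≤ κ₀ * (((F.L : ℝ) ^ (K - n)) ^ 2)⁻¹ / 8 := by
  have hL1 : (1 : ℝ) ≤ (F.L : ℝ) := by have := F.hL.2; exact_mod_cast (by omega : 1 ≤ F.L)
  set ℓ : ℝ := (F.L : ℝ) ^ (K - n) with hℓ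
  have hℓ1 : 1 ≤ ℓ := one_le_pow₀ hL1
  have hℓ0 : 0 < ℓ := by linarith
  have hthr : regThreshold F n K e = e * (ℓ ^ 2)⁻¹ := by
    unfold regThreshold
    rw [inv_pow, pow_mul', hℓ]
  rw [hthr]
  have hkey : 15552 * (s₀ * ℓ⁻¹) ^ 2 + 216 * (e * (ℓ ^ 2)⁻¹) + 2 * e * C₁ * (ℓ ^ 2)⁻¹
      = (ℓ ^ 2)⁻¹ * (15552 * s₀ ^ 2 + 216 * e + 2 * e * C₁) := by
    field_simp
  rw [hkey]
  have hmono : 15552 * s₀ ^ 2 + 216 * e + 2 * e * C₁ ≤ κ₀ / 8 := by nlinarith [mul_le_mul_of_nonneg_right he hC₁]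
  have hi0 : 0 ≤ (ℓ ^ 2)⁻¹ := by positivity
  have := mul_le_mul_of_nonneg_left hmono hi0
  calc (ℓ ^ 2)⁻¹ * (15552 * s₀ ^ 2 + 216 * e + 2 * e * C₁) ≤ (ℓ ^ 2)⁻¹ * (κ₀ / 8) := this
    _ = κ₀ * (ℓ ^ 2)⁻¹ / 8 := by ring

set_option maxHeartbeats 400000 in
/-- ★★★ **ROW E′ ([Balaban1985Variational] (141)–(142) in print's regime) FROM CHART_W ∧ HESS_W′ ∧ THE JOINT REMAINDER ROW IN THEIR NATURAL SCALINGS, MULTIPLIER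
CURRENCY.**  For every `L > 1` constants `e₆ > 0` with `10¹⁰L⁶e₆ ≤ 1`, `0 ≤ s₀` with `4s₀ ≤ 1`, `C₁, C₂ ≥ 0` with `16e₆C₂ ≤ 1`, `κ₀` with
`15552s₀² + 216e₆ + 2e₆C₁ ≤ κ₀∕8`, such that at every member `(F, n, K)`, every radius `0 < e ≤ e₆`, every datum `V`, every R2-critical `W ∈ (6)(e) ∩ 𝔅_k(V)` and
every recursion family `Q` of the true one-step linearisations along `W`'s tower, the rows CHART_W (radius `s₀·L^{−(K−n)}`), HESS_W′ (`κ₀·L^{−2(K−n)}`) and JOINT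
(`Σ_c‖(Q (K−n) (iD))(c)‖ ≤ C₁·L^{−(K−n)}·Σ‖D‖² + C₂·L^{K−n}·Σ_p‖ℒ_p(D)‖²`) hold for every competitor.  CONCLUSION = the E′ text verbatim (`e₅ := e₆`, `a₁'' := 1`);
(141) in multiplier form and the Taylor row are theorems; no Σ_k-curve, no velocity, no normal-correction constant.
[cite: Balaban1985Variational, (141)-(142) p.299, Prop. 7 p.299, (4)-(7) p.278, (14) p.280, (47)-(48) pp.285-286, (80) p.290, (116) p.295; Balaban1985BackgroundPropagators, (3.9)-(3.11) p.392] -/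
theorem stub_PV3E_of_multiplierRows
    (hrowsU : ∀ (L : ℕ), 1 < L → ∃ e₆ s₀ C₁ C₂ κ₀ : ℝ, 0 < e₆ ∧ 10 ^ 10 * (L : ℝ) ^ 6 * e₆ ≤ 1 ∧ 0 ≤ s₀ ∧ 4 * s₀ ≤ 1 ∧ 0 ≤ C₁ ∧ 0 ≤ C₂ ∧ 16 * e₆ * C₂ ≤ 1 ∧
      15552 * s₀ ^ 2 + 216 * e₆ + 2 * e₆ * C₁ ≤ κ₀ / 8 ∧
      ∀ (F : T3Family), F.L = L → ∀ (n K : ℕ) (hnK : n < K) (e : ℝ) (V : GaugeField (F.P n) 0 (Matrix.specialUnitaryGroup (Fin 2) ℂ))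
        (W : GaugeField (F.P K) 0 (Matrix.specialUnitaryGroup (Fin 2) ℂ)),
        0 < e → e ≤ e₆ → W ∈ regFibrePr F n K hnK.le e V → IsCritR2 F n K hnK.le V W →
        ∀ (Q : (k : ℕ) → (PBond (F.P K) 0 → Matrix (Fin 2) (Fin 2) ℂ) → PBond (F.P K) k → Matrix (Fin 2) (Fin 2) ℂ), (∀ Y, Q 0 Y = Y) →
        (∀ (k : ℕ) (Y : PBond (F.P K) 0 → Matrix (Fin 2) (Fin 2) ℂ) (c : PBond (F.P K) (k + 1)), Q (k + 1) Y c
          = fderiv ℂ (eml : (Idx (F.P K) → Matrix (Fin 2) (Fin 2) ℂ) → Matrix (Fin 2) (Fin 2) ℂ)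
              (fun i => ((loopHol (Averaging.iter (fun i => blockAvg (P := F.P K) (j := i) (expMeanLogSU (n := Fin 2))) k W) c i :
                Matrix.specialUnitaryGroup (Fin 2) ℂ) : Matrix (Fin 2) (Fin 2) ℂ))
              (fun i => covWalkSum (Averaging.iter (fun i => blockAvg (P := F.P K) (j := i) (expMeanLogSU (n := Fin 2))) k W) (Q k Y)
                  (walk (emb c.src) (loopWord (F.P K).L c.dir (off i.1) i.2.1 i.2.2))
                * ((loopHol (Averaging.iter (fun i => blockAvg (P := F.P K) (j := i) (expMeanLogSU (n := Fin 2))) k W) c i :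
                  Matrix.specialUnitaryGroup (Fin 2) ℂ) : Matrix (Fin 2) (Fin 2) ℂ))
              * star ((corr (expMeanLogSU (n := Fin 2)) (Averaging.iter (fun i => blockAvg (P := F.P K) (j := i) (expMeanLogSU (n := Fin 2))) k W) c :
                  Matrix.specialUnitaryGroup (Fin 2) ℂ) : Matrix (Fin 2) (Fin 2) ℂ)
            + ((corr (expMeanLogSU (n := Fin 2)) (Averaging.iter (fun i => blockAvg (P := F.P K) (j := i) (expMeanLogSU (n := Fin 2))) k W) c :
                  Matrix.specialUnitaryGroup (Fin 2) ℂ) : Matrix (Fin 2) (Fin 2) ℂ)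
              * covWalkSum (Averaging.iter (fun i => blockAvg (P := F.P K) (j := i) (expMeanLogSU (n := Fin 2))) k W) (Q k Y)
                  (walk (emb c.src) (List.replicate (F.P K).L (c.dir, true)))
              * star ((corr (expMeanLogSU (n := Fin 2)) (Averaging.iter (fun i => blockAvg (P := F.P K) (j := i) (expMeanLogSU (n := Fin 2))) k W) c :
                  Matrix.specialUnitaryGroup (Fin 2) ℂ) : Matrix (Fin 2) (Fin 2) ℂ)) →
        ∀ W' : GaugeField (F.P K) 0 (Matrix.specialUnitaryGroup (Fin 2) ℂ), W' ∈ regFibrePr F n K hnK.le e V →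
          ∃ (D : PBond (F.P K) 0 → Matrix (Fin 2) (Fin 2) ℂ),
            (∀ b : PBond (F.P K) 0, (D b).IsHermitian ∧ Matrix.trace (D b) = 0) ∧ (∀ b : PBond (F.P K) 0, ‖D b‖ ≤ s₀ * ((F.L : ℝ) ^ (K - n))⁻¹) ∧
            wilsonAction4 W' = wilsonAction4 (emb15 W (expHermField D)) ∧
            κ₀ * (((F.L : ℝ) ^ (K - n)) ^ 2)⁻¹ * ∑ b : PBond (F.P K) 0, ‖D b‖ ^ 2
              ≤ ∑ p : Plaq (F.P K) 0, ‖((Complex.I • D ⟨p.src, p.μ⟩) + ((W ⟨p.src, p.μ⟩ : Matrix (Fin 2) (Fin 2) ℂ) * (Complex.I • D ⟨p.src.shift p.μ, p.ν⟩) * star (W ⟨p.src, p.μ⟩ : Matrix (Fin 2) (Fin 2) ℂ))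
            - (((W ⟨p.src, p.μ⟩ * W ⟨p.src.shift p.μ, p.ν⟩ * (W ⟨p.src.shift p.ν, p.μ⟩)⁻¹ : Matrix.specialUnitaryGroup (Fin 2) ℂ) : Matrix (Fin 2) (Fin 2) ℂ) * (Complex.I • D ⟨p.src.shift p.ν, p.μ⟩) * star ((W ⟨p.src, p.μ⟩ * W ⟨p.src.shift p.μ, p.ν⟩ * (W ⟨p.src.shift p.ν, p.μ⟩)⁻¹ : Matrix.specialUnitaryGroup (Fin 2) ℂ) : Matrix (Fin 2) (Fin 2) ℂ))
            - (((GaugeField.plaqHol W p : Matrix.specialUnitaryGroup (Fin 2) ℂ) : Matrix (Fin 2) (Fin 2) ℂ) * (Complex.I • D ⟨p.src, p.ν⟩) * star ((GaugeField.plaqHol W p : Matrix.specialUnitaryGroup (Fin 2) ℂ) : Matrix (Fin 2) (Fin 2) ℂ)))‖ ^ 2 ∧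
            ∑ c : PBond (F.P K) (K - n), ‖Q (K - n) (fun b => Complex.I • D b) c‖
              ≤ C₁ * ((F.L : ℝ) ^ (K - n))⁻¹ * ∑ b : PBond (F.P K) 0, ‖D b‖ ^ 2
                + C₂ * (F.L : ℝ) ^ (K - n) * ∑ p : Plaq (F.P K) 0, ‖((Complex.I • D ⟨p.src, p.μ⟩) + ((W ⟨p.src, p.μ⟩ : Matrix (Fin 2) (Fin 2) ℂ) * (Complex.I • D ⟨p.src.shift p.μ, p.ν⟩) * star (W ⟨p.src, p.μ⟩ : Matrix (Fin 2) (Fin 2) ℂ))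
            - (((W ⟨p.src, p.μ⟩ * W ⟨p.src.shift p.μ, p.ν⟩ * (W ⟨p.src.shift p.ν, p.μ⟩)⁻¹ : Matrix.specialUnitaryGroup (Fin 2) ℂ) : Matrix (Fin 2) (Fin 2) ℂ) * (Complex.I • D ⟨p.src.shift p.ν, p.μ⟩) * star ((W ⟨p.src, p.μ⟩ * W ⟨p.src.shift p.μ, p.ν⟩ * (W ⟨p.src.shift p.ν, p.μ⟩)⁻¹ : Matrix.specialUnitaryGroup (Fin 2) ℂ) : Matrix (Fin 2) (Fin 2) ℂ))
            - (((GaugeField.plaqHol W p : Matrix.specialUnitaryGroup (Fin 2) ℂ) : Matrix (Fin 2) (Fin 2) ℂ) * (Complex.I • D ⟨p.src, p.ν⟩) * star ((GaugeField.plaqHol W p : Matrix.specialUnitaryGroup (Fin 2) ℂ) : Matrix (Fin 2) (Fin 2) ℂ)))‖ ^ 2) :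
    ∀ (L : ℕ), 1 < L → ∀ (B₃ : ℝ), 4 < B₃ →
    ∃ e₅ a₁'' : ℝ, 0 < e₅ ∧ 0 < a₁'' ∧ ∀ (i : Idx L) (e ε₁ : ℝ) (V : GaugeField (i.1.1.P i.1.2.1) 0 (Matrix.specialUnitaryGroup (Fin 2) ℂ))
      (U₀ W : GaugeField (i.1.1.P i.1.2.2) 0 (Matrix.specialUnitaryGroup (Fin 2) ℂ)),
      0 < ε₁ → ε₁ ≤ a₁'' → PlaqSmall ε₁ V → (L : ℝ) ^ 3 * B₃ * ε₁ ≤ e → e ≤ e₅ →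
      RegPr i.1.1 i.1.2.1 i.1.2.2 ((L : ℝ) ^ 3 * B₃ * ε₁) U₀ → CloseAvg i.1.1 i.1.2.1 i.1.2.2 i.2.2.le ((L : ℝ) ^ 3 * ε₁) V U₀ →
      W ∈ regFibrePr i.1.1 i.1.2.1 i.1.2.2 i.2.2.le e V → IsCritR2 i.1.1 i.1.2.1 i.1.2.2 i.2.2.le V W →
        IsMinOn (fun W' : GaugeField (i.1.1.P i.1.2.2) 0 (Matrix.specialUnitaryGroup (Fin 2) ℂ) => wilsonAction4 W')
          (regFibrePr i.1.1 i.1.2.1 i.1.2.2 i.2.2.le e V) W := by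
  intro L hL B₃ hB₃
  obtain ⟨e₆, s₀, C₁, C₂, κ₀, he₆, he₆L, hs₀, hs₀4, hC₁, hC₂, hC₂e, hsmall, H⟩ := hrowsU L hL
  refine ⟨e₆, 1, he₆, one_pos, ?_⟩
  intro i e ε₁ V U₀ W hε₁ _hε₁a _hV hlo hhi _hRU₀ _hclose hW hWcrit
  obtain ⟨⟨F, n, K⟩, hF, hnK⟩ := i
  have hL0 : (0 : ℝ) < (L : ℝ) := by exact_mod_cast (show 0 < L by omega)
  have he0 : 0 < e := lt_of_lt_of_le (by positivity) hlo
  have hL1 : (1 : ℝ) ≤ (F.L : ℝ) := by have := F.hL.2; exact_mod_cast (by omega : 1 ≤ F.L)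
  have hℓ1 : (1 : ℝ) ≤ (F.L : ℝ) ^ (K - n) := one_le_pow₀ hL1
  have hℓ0 : (0 : ℝ) < (F.L : ℝ) ^ (K - n) := by linarith
  -- the scaled radius is `≤ s₀`, hence `4s ≤ 1`
  have hs4 : 4 * (s₀ * ((F.L : ℝ) ^ (K - n))⁻¹) ≤ 1 := by
    have hi : ((F.L : ℝ) ^ (K - n))⁻¹ ≤ 1 := inv_le_one_of_one_le₀ hℓ1
    nlinarith [mul_le_mul_of_nonneg_left hi hs₀]
  -- the window `10¹⁰L⁶e ≤ 1` at this member and `2eC₂ ≤ ⅛`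
  have heL : 10 ^ 10 * (F.L : ℝ) ^ 6 * e ≤ 1 := by
    have hFL : (F.L : ℝ) = (L : ℝ) := by exact_mod_cast hF
    rw [hFL]
    have : 10 ^ 10 * (L : ℝ) ^ 6 * e ≤ 10 ^ 10 * (L : ℝ) ^ 6 * e₆ := mul_le_mul_of_nonneg_left hhi (by positivity)
    exact this.trans he₆L
  have hθ : 2 * e * C₂ ≤ 1 / 8 := by nlinarith [mul_le_mul_of_nonneg_right hhi hC₂]
  -- a recursion family at `W` (zero content) and the rows at it
  obtain ⟨Q, hQ0, hQs⟩ := exists_trueLinIter_family (N := 2) W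
  exact isMinOn_regFibrePr_of_multiplierRows_at F hnK.le V hWcrit hW heL Q hQ0 hQs
    (H F hF n K hnK e V W he0 hhi hW hWcrit Q hQ0 hQs) hs4 hθ (scaled_smallness_mult F n K hhi hC₁ hsmall)

end Summit.QuantumFields.YangMills.Theorems.Prop7LocMinOfMultiplierRows

end
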